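import Summits.ABC.ABC.Theses.IsogenyGlueCongruence
import Summits.ABC.ABC.Theorems.IsogenyGlueCongruenceSharpDegreeOfPolyDegreeValuation
import Summits.ABC.ABC.Theorems.IsogenyGlueCongruenceSharpDegreeOfPolyDegreeOptimalComparison
import Summits.ABC.ABC.Theorems.IsogenyGlueCongruenceSharpDegreeOfPolyDegreeTakahashiBound
import Summits.ABC.ABC.Theorems.IsogenyGlueCongruenceSharpDegreeOfPolyDegreeXiSharpOfSharp
import Literature.NumberTheory.EllipticCurves.ModularDegreeMinimal
import Literature.NumberTheory.EllipticCurves.PastenSpectralDegree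
import Literature.NumberTheory.Automorphic.BrandtXi

set_option linter.dupNamespace false

/-!
# Crux `SharpDegreeOfPolyDegree` (stmt-ABC-10895), line `Sketch`: the relocation theorem

`R := SharpDegreeOfPolyDegree = (Poly → X)`, `Poly` = the polynomial modular-degree bound for
semistable curves (`∃ κ C, deg ≤ C N^κ`, `∃D`-form), `X = SemistableDegreeConjecture`
(`∀ ε > 0 ∃ C, deg ≤ C N^{2+ε}`).  The line `Sketch` (card `oldforms-free-under-poly`) reduces `R` to
its residual stub C⁺ — under Poly, `ξ(E; N/q, q) ≤ C_ε N^{2+ε}` for every semistable `E/ℚ` in global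
minimal form and every odd prime `q ∣ N`, `ξ = brandtXi (N/q) q (a(E))` the definite congruence
number — plus the landed stubs L0 (`stub_valuationLogBound`), OC (`stub_optimalComparison`), TB
(`stub_takahashiBound`) and two named facts.  This support file (lands `--supports stmt-ABC-10895`)
turns the line's skeleton (`Cruxes/SharpDegreeOfPolyDegree/Lines/Sketch.lean`, composition proved
modulo stubs) into sorry-free CONDITIONAL theorems and records what the line is worth:

* `degreeBound_of_brandtXiBound` — the composition at a general exponent: granted
  `takahashi2001_thm_2_3` and `PastenShimura2024_minimalDegree_le_163_mul`, under Poly a bound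
  `ξ(E; N/q, q) ≤ C₁ N^θ` (all semistable `E`, all odd primes `q ∣ N`) gives `deg_min(E) ≤ C N^{θ+η}`
  for every `η > 0` (`deg_min ≤ 163 · deg D₀ ≤ 163 · ξ · v_q(Δ_min E₀) ≤ 163 C₁ N^θ · A(log N + 1)`).
* `brandtXiBound_of_degreeBound` — the converse transfer at a general exponent, from
  `takahashi2001_thm_2_3` alone (`ξ ≤ deg · v_q` at the optimal curve, landed as
  `exists_brandtXi_le_modularDegree_mul`).
* `sharpDegreeOfPolyDegree_of_xiSharpUnderPoly` : facts → C⁺ → `R` (the skeleton's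
  `SharpDegreeOfPolyDegree_of` with its three open stubs as hypotheses), and
  **`xiSharpUnderPoly_iff_sharpDegreeOfPolyDegree` : facts → (C⁺ ↔ R)** — the residual stub is an
  EXACT relocation of the crux to the definite side; `…_of_mazurKenkuBound` phrase the `163`-fact as
  the route item `MazurKenkuBound` (stmt-ABC-15125, definitionally the same statement).
* the companion file `IsogenyGlueCongruenceSharpDegreeOfPolyDegreeXiExponentFloor.lean` runs the two
  transfers at every exponent `θ` and combines them with the landed exponent floor of the target
  (`Theorems/SharpDegreeOfPolyDegree/Negative/ExponentFloor.lean`): the `2` in C⁺ is as sharp as the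
  `2` in `X` (below `3/2` unconditionally, below `2` modulo `PeterssonLowerBound`, "Poly ⟹ ξ-bound"
  holds iff Poly fails), so C⁺ carries the full abc-strength of `R`.

Theorems only (no definition, no named fact discharged); `R` itself is not closed here.
-/

noncomputable section

namespace Summit.ABC.ABC.Theorems.SharpDegreeOfPolyDegree

open Summit.ABC.ABC.Theses.IsogenyGlueCongruence
open Literature.NumberTheory.EllipticCurves Literature.NumberTheory.EllipticCurves.ModularForms
open Literature.NumberTheory.DiophantineGeometry Literature.NumberTheory.Automorphic
open WeierstrassCurve

/-! ## Elementary helpers -/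

/-- Conductors of semistable curves with no odd prime factor are `≤ 2` (squarefree and a power of
`2`). [folklore] -/
theorem conductorNorm_le_two_of_forall_eq_two (W : WeierstrassCurve ℚ) [W.IsElliptic]
    (hss : W.IsSemistable ℤ) (h : ∀ q : ℕ, q.Prime → q ∣ W.conductorNorm ℤ → q = 2) :
    W.conductorNorm ℤ ≤ 2 := by
  have hsq : Squarefree (W.conductorNorm ℤ) := (W.isSemistable_iff_squarefree_conductorNorm).mp hss
  have hN0 : W.conductorNorm ℤ ≠ 0 := hsq.ne_zero
  set k := (W.conductorNorm ℤ).primeFactorsList.length with hk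
  have hpow : W.conductorNorm ℤ = 2 ^ k :=
    Nat.eq_prime_pow_of_unique_prime_dvd hN0 (fun {d} hd hdvd => h d hd hdvd)
  by_contra hlt
  push Not at hlt
  have hk2 : 2 ≤ k := by
    by_contra hk1
    push Not at hk1
    have hle : W.conductorNorm ℤ ≤ 2 := by
      rw [hpow]
      calc 2 ^ k ≤ 2 ^ 1 := Nat.pow_le_pow_right (by norm_num) (by omega)
        _ = 2 := by norm_num
    omega
  have h4 : 2 * 2 ∣ W.conductorNorm ℤ := by
    rw [hpow]
    exact ⟨2 ^ (k - 2), by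
      rw [show (2 : ℕ) * 2 = 2 ^ 2 by norm_num, ← pow_add, Nat.add_sub_cancel' hk2]⟩
  have := hsq 2 h4
  norm_num at this

/-- `(N : ℝ) ^ κ ≤ 2 ^ |κ|` when `1 ≤ N ≤ 2`. [folklore] -/
theorem rpow_le_two_rpow_abs {N : ℝ} (h1 : 1 ≤ N) (h2 : N ≤ 2) (κ : ℝ) :
    N ^ κ ≤ (2 : ℝ) ^ |κ| := by
  rcases le_or_gt 0 κ with hκ | hκ
  · calc N ^ κ ≤ (2 : ℝ) ^ κ := Real.rpow_le_rpow (by linarith) h2 hκ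
      _ = (2 : ℝ) ^ |κ| := by rw [abs_of_nonneg hκ]
  · calc N ^ κ ≤ 1 := Real.rpow_le_one_of_one_le_of_nonpos h1 hκ.le
      _ ≤ (2 : ℝ) ^ |κ| := Real.one_le_rpow (by norm_num) (abs_nonneg κ)

/-- `2 ^ (-|s|) ≤ (N : ℝ) ^ s` when `1 ≤ N ≤ 2`. [folklore] -/
theorem two_rpow_neg_abs_le_rpow {N : ℝ} (h1 : 1 ≤ N) (h2 : N ≤ 2) (s : ℝ) :
    (2 : ℝ) ^ (-|s|) ≤ N ^ s := by
  rcases le_or_gt 0 s with hs | hs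
  · calc (2 : ℝ) ^ (-|s|) ≤ 1 :=
          Real.rpow_le_one_of_one_le_of_nonpos (by norm_num) (by simp [abs_nonneg])
      _ ≤ N ^ s := Real.one_le_rpow h1 hs
  · rw [abs_of_neg hs, neg_neg]
    exact Real.rpow_le_rpow_of_nonpos (by linarith) h2 hs.le

/-! ## The composition at a general exponent (C⁺-type bound ⟹ degree bound) -/

/-- **The line's composition, at a general exponent.** Granted `takahashi2001_thm_2_3` and
`PastenShimura2024_minimalDegree_le_163_mul`, under Poly a bound `ξ(E; N/q, q) ≤ C₁ N^θ` for every
semistable `E/ℚ` in global minimal form and every odd prime `q ∣ N` yields, for every `η > 0`, a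
constant `C` with: every such `E` has a datum of degree `≤ C N^{θ+η}`.  For an odd prime `q ∣ N`:
`deg_min(E) ≤ 163 · deg D₀` (OC) `≤ 163 · ξ(E; N/q, q) · v_q(Δ_min E₀)` (TB at the optimal curve `E₀`,
same `a`-sequence and conductor) `≤ 163 C₁ N^θ · max(A,0)(1/η + 1) N^η` (L0 at `E₀`, `log q ≥ 1`,
`log N + 1 ≤ (1/η+1) N^η`); for `N ∈ {1, 2}` the Poly datum will do (`deg ≤ C₀ N^κ ≤ C₀ 2^{|κ|}` and
`N^{θ+η} ≥ 2^{−|θ+η|}`). [cite: Takahashi2001, Thm. 2.3] [cite: PastenShimura2024, §3 p. 13] -/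
theorem degreeBound_of_brandtXiBound (hT : takahashi2001_thm_2_3)
    (h163 : PastenShimura2024_minimalDegree_le_163_mul)
    (hPoly : ∃ κ C : ℝ, ∀ (W : WeierstrassCurve ℚ) [W.IsElliptic] [W.IsGloballyMinimal]
      [NeZero (W.conductorNorm ℤ)], W.IsSemistable ℤ →
        ∃ D : ModularParametrizationData W (W.conductorNorm ℤ),
          (D.modularDegree : ℝ) ≤ C * (W.conductorNorm ℤ : ℝ) ^ κ)
    {θ C₁ : ℝ}
    (hξ : ∀ (W : WeierstrassCurve ℚ) [W.IsElliptic] [W.IsGloballyMinimal]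
      [NeZero (W.conductorNorm ℤ)], W.IsSemistable ℤ → ∀ q : ℕ, q.Prime → q ≠ 2 →
        q ∣ W.conductorNorm ℤ →
          (brandtXi (W.conductorNorm ℤ / q) q (fun n => W.LFunction n) : ℝ) ≤
            C₁ * (W.conductorNorm ℤ : ℝ) ^ θ)
    {η τ : ℝ} (hη : 0 < η) (hτ : θ + η = τ) :
    ∃ C : ℝ, ∀ (W : WeierstrassCurve ℚ) [W.IsElliptic] [W.IsGloballyMinimal]
      [NeZero (W.conductorNorm ℤ)], W.IsSemistable ℤ →
        ∃ D : ModularParametrizationData W (W.conductorNorm ℤ),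
          (D.modularDegree : ℝ) ≤ C * (W.conductorNorm ℤ : ℝ) ^ τ := by
  obtain ⟨κ, C₀, hC₀⟩ := id hPoly
  obtain ⟨A, hA⟩ := stub_valuationLogBound hPoly
  have hOC := stub_optimalComparison h163
  have hTB := stub_takahashiBound hT
  set K : ℝ := 163 * (max C₁ 0 * (max A 0 * (1 / η + 1))) with hK
  have hK0 : 0 ≤ K := by positivity
  set K₂ : ℝ := max C₀ 0 * (2 : ℝ) ^ |κ| * (2 : ℝ) ^ |τ| with hK₂
  have hK₂0 : 0 ≤ K₂ := by positivity
  refine ⟨max K₂ K, ?_⟩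
  intro W _ _ _ hss
  have hNpos : 0 < W.conductorNorm ℤ := Nat.pos_of_ne_zero (NeZero.ne _)
  have hN1 : (1 : ℝ) ≤ (W.conductorNorm ℤ : ℝ) := by exact_mod_cast hNpos
  have hN0 : (0 : ℝ) < (W.conductorNorm ℤ : ℝ) := by linarith
  have hCle : K ≤ max K₂ K := le_max_right _ _
  -- the datum supplied by Poly
  obtain ⟨DP, hDP⟩ := hC₀ W hss
  by_cases hodd : ∃ q : ℕ, q.Prime ∧ q ≠ 2 ∧ q ∣ W.conductorNorm ℤ
  · obtain ⟨q, hq, hq2, hqN⟩ := hodd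
    -- a minimal-degree datum of `W` exists
    obtain ⟨D, -, hmin⟩ := exists_minimal_datum (W := W) (N := W.conductorNorm ℤ) ⟨DP⟩
    refine ⟨D, ?_⟩
    -- the optimal comparison and Takahashi's bound at the optimal curve
    obtain ⟨W₀, hW₀, D₀, hss₀, hN₀, ha₀, hmin₀, h163'⟩ := hOC W hss D hmin
    haveI := hW₀
    have hsq : Squarefree (W.conductorNorm ℤ) :=
      (W.isSemistable_iff_squarefree_conductorNorm).mp hss
    have hTB' := hTB W₀ (W.conductorNorm ℤ) hN₀ hsq q hq hqN D₀ hmin₀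
    have hfun : (fun n => W₀.LFunction n) = (fun n => W.LFunction n) := funext ha₀
    rw [hfun] at hTB'
    have h2 := hξ W hss q hq hq2 hqN
    have h3 := hA W₀ hss₀ q hq
    rw [hN₀] at h3
    -- abbreviations
    set N : ℝ := (W.conductorNorm ℤ : ℝ) with hNdef
    set ξ : ℝ := (brandtXi (W.conductorNorm ℤ / q) q (fun n => W.LFunction n) : ℝ) with hξdef
    set v : ℝ := (((W₀.minimalDiscriminantNorm ℤ).factorization q : ℕ) : ℝ) with hv
    have hξ0 : 0 ≤ ξ := by rw [hξdef]; exact Nat.cast_nonneg _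
    have hv0 : 0 ≤ v := by rw [hv]; exact Nat.cast_nonneg _
    have hNb : 0 ≤ N ^ θ := Real.rpow_nonneg hN0.le _
    -- `deg D ≤ 163 ξ v`
    have h1 : (D.modularDegree : ℝ) ≤ 163 * (ξ * v) := by
      have h1' : (D.modularDegree : ℝ) ≤ 163 * (D₀.modularDegree : ℝ) := by exact_mod_cast h163'
      have h1'' : (D₀.modularDegree : ℝ) ≤ ξ * v := by rw [hξdef, hv]; exact_mod_cast hTB'
      linarith
    -- `v ≤ max A 0 · (1/η + 1) · N^η`
    have hlog1 : (1 : ℝ) ≤ Real.log q := one_le_log_of_odd_prime hq hq2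
    have hlogN : 0 ≤ Real.log N := Real.log_nonneg hN1
    have hv1 : v ≤ max A 0 * ((1 / η + 1) * N ^ η) := by
      calc v ≤ v * Real.log q := le_mul_of_one_le_right hv0 hlog1
        _ ≤ A * Real.log N + A := h3
        _ ≤ max A 0 * Real.log N + max A 0 :=
            add_le_add (mul_le_mul_of_nonneg_right (le_max_left _ _) hlogN) (le_max_left _ _)
        _ = max A 0 * (Real.log N + 1) := by ring
        _ ≤ max A 0 * ((1 / η + 1) * N ^ η) :=
            mul_le_mul_of_nonneg_left (log_add_one_le hN1 hη) (le_max_right _ _)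
    -- `ξ ≤ max C₁ 0 · N^θ`
    have hξ1 : ξ ≤ max C₁ 0 * N ^ θ :=
      h2.trans (mul_le_mul_of_nonneg_right (le_max_left _ _) hNb)
    -- exponents
    have hexp : N ^ θ * N ^ η = N ^ τ := by
      rw [← Real.rpow_add hN0, hτ]
    calc (D.modularDegree : ℝ) ≤ 163 * (ξ * v) := h1
      _ ≤ 163 * ((max C₁ 0 * N ^ θ) * (max A 0 * ((1 / η + 1) * N ^ η))) :=
          mul_le_mul_of_nonneg_left (mul_le_mul hξ1 hv1 hv0 (le_trans hξ0 hξ1)) (by norm_num)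
      _ = K * (N ^ θ * N ^ η) := by rw [hK]; ring
      _ = K * N ^ τ := by rw [hexp]
      _ ≤ max K₂ K * N ^ τ := mul_le_mul_of_nonneg_right hCle (Real.rpow_nonneg hN0.le _)
  · -- no odd prime divides `N`: `N ≤ 2`, use the Poly datum
    push Not at hodd
    have hle2 : W.conductorNorm ℤ ≤ 2 :=
      conductorNorm_le_two_of_forall_eq_two W hss (fun q hq hqN => by
        by_contra h; exact hodd q hq h hqN)
    have hN2 : (W.conductorNorm ℤ : ℝ) ≤ 2 := by exact_mod_cast hle2
    have hlow : (2 : ℝ) ^ (-|τ|) ≤ (W.conductorNorm ℤ : ℝ) ^ τ := two_rpow_neg_abs_le_rpow hN1 hN2 τ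
    refine ⟨DP, hDP.trans ?_⟩
    calc C₀ * (W.conductorNorm ℤ : ℝ) ^ κ ≤ max C₀ 0 * (W.conductorNorm ℤ : ℝ) ^ κ :=
          mul_le_mul_of_nonneg_right (le_max_left _ _) (Real.rpow_nonneg hN0.le _)
      _ ≤ max C₀ 0 * (2 : ℝ) ^ |κ| :=
          mul_le_mul_of_nonneg_left (rpow_le_two_rpow_abs hN1 hN2 κ) (le_max_right _ _)
      _ = K₂ * (2 : ℝ) ^ (-|τ|) := by
          rw [hK₂, mul_assoc (max C₀ 0 * (2 : ℝ) ^ |κ|), ← Real.rpow_add (by norm_num : (0 : ℝ) < 2),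
            add_neg_cancel, Real.rpow_zero, mul_one]
      _ ≤ K₂ * (W.conductorNorm ℤ : ℝ) ^ τ := mul_le_mul_of_nonneg_left hlow hK₂0
      _ ≤ max K₂ K * (W.conductorNorm ℤ : ℝ) ^ τ :=
          mul_le_mul_of_nonneg_right (le_max_left _ _) (Real.rpow_nonneg hN0.le _)

/-! ## The converse transfer at a general exponent (degree bound ⟹ C⁺-type bound) -/

/-- **Degree bound ⟹ `ξ`-bound, at a general exponent.** Granted `takahashi2001_thm_2_3`, under
Poly a bound `deg D ≤ C N^τ` (some datum of every semistable `E` in global minimal form) gives, for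
every `η > 0`, a constant `C'` with `ξ(E; N/q, q) ≤ C' N^{τ+η}` for every such `E` and every odd prime
`q ∣ N`: `ξ ≤ deg D · v_q(Δ_min E₀)` at the optimal curve `E₀`
(`exists_brandtXi_le_modularDegree_mul`) and `v_q ≤ max(A,0)(1/η + 1) N^η` (L0 at `E₀`).
[cite: Takahashi2001, Thm. 2.3] -/
theorem brandtXiBound_of_degreeBound (hT : takahashi2001_thm_2_3)
    (hPoly : ∃ κ C : ℝ, ∀ (W : WeierstrassCurve ℚ) [W.IsElliptic] [W.IsGloballyMinimal]
      [NeZero (W.conductorNorm ℤ)], W.IsSemistable ℤ →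
        ∃ D : ModularParametrizationData W (W.conductorNorm ℤ),
          (D.modularDegree : ℝ) ≤ C * (W.conductorNorm ℤ : ℝ) ^ κ)
    {τ C : ℝ}
    (hX : ∀ (W : WeierstrassCurve ℚ) [W.IsElliptic] [W.IsGloballyMinimal]
      [NeZero (W.conductorNorm ℤ)], W.IsSemistable ℤ →
        ∃ D : ModularParametrizationData W (W.conductorNorm ℤ),
          (D.modularDegree : ℝ) ≤ C * (W.conductorNorm ℤ : ℝ) ^ τ)
    {η σ : ℝ} (hη : 0 < η) (hσ : τ + η = σ) :
    ∃ C' : ℝ, ∀ (W : WeierstrassCurve ℚ) [W.IsElliptic] [W.IsGloballyMinimal]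
      [NeZero (W.conductorNorm ℤ)], W.IsSemistable ℤ → ∀ q : ℕ, q.Prime → q ≠ 2 →
        q ∣ W.conductorNorm ℤ →
          (brandtXi (W.conductorNorm ℤ / q) q (fun n => W.LFunction n) : ℝ) ≤
            C' * (W.conductorNorm ℤ : ℝ) ^ σ := by
  obtain ⟨A, hA⟩ := stub_valuationLogBound hPoly
  refine ⟨max C 0 * (max A 0 * (1 / η + 1)), ?_⟩
  intro W _ _ _ hss q hq hq2 hqN
  have hNpos : 0 < W.conductorNorm ℤ := Nat.pos_of_ne_zero (NeZero.ne _)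
  have hN1 : (1 : ℝ) ≤ (W.conductorNorm ℤ : ℝ) := by exact_mod_cast hNpos
  have hN0 : (0 : ℝ) < (W.conductorNorm ℤ : ℝ) := by linarith
  obtain ⟨DX, hDX⟩ := hX W hss
  obtain ⟨W₀, hW₀, hss₀, hN₀, hle⟩ := exists_brandtXi_le_modularDegree_mul hT W hss DX hq hqN
  haveI := hW₀
  have h3 := hA W₀ hss₀ q hq
  rw [hN₀] at h3
  set N : ℝ := (W.conductorNorm ℤ : ℝ) with hNdef
  set v : ℝ := (((W₀.minimalDiscriminantNorm ℤ).factorization q : ℕ) : ℝ) with hv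
  have hv0 : 0 ≤ v := by rw [hv]; exact Nat.cast_nonneg _
  have hNτ : 0 ≤ N ^ τ := Real.rpow_nonneg hN0.le _
  have h1 : (brandtXi (W.conductorNorm ℤ / q) q (fun n => W.LFunction n) : ℝ) ≤
      (DX.modularDegree : ℝ) * v := by rw [hv]; exact_mod_cast hle
  have h2 : (DX.modularDegree : ℝ) ≤ max C 0 * N ^ τ :=
    hDX.trans (mul_le_mul_of_nonneg_right (le_max_left _ _) hNτ)
  have hlog1 : (1 : ℝ) ≤ Real.log q := one_le_log_of_odd_prime hq hq2
  have hlogN : 0 ≤ Real.log N := Real.log_nonneg hN1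
  have hv1 : v ≤ max A 0 * ((1 / η + 1) * N ^ η) := by
    calc v ≤ v * Real.log q := le_mul_of_one_le_right hv0 hlog1
      _ ≤ A * Real.log N + A := h3
      _ ≤ max A 0 * Real.log N + max A 0 :=
          add_le_add (mul_le_mul_of_nonneg_right (le_max_left _ _) hlogN) (le_max_left _ _)
      _ = max A 0 * (Real.log N + 1) := by ring
      _ ≤ max A 0 * ((1 / η + 1) * N ^ η) :=
          mul_le_mul_of_nonneg_left (log_add_one_le hN1 hη) (le_max_right _ _)
  have hexp : N ^ τ * N ^ η = N ^ σ := by rw [← Real.rpow_add hN0, hσ]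
  have hdeg0 : 0 ≤ (DX.modularDegree : ℝ) := Nat.cast_nonneg _
  calc (brandtXi (W.conductorNorm ℤ / q) q (fun n => W.LFunction n) : ℝ)
        ≤ (DX.modularDegree : ℝ) * v := h1
    _ ≤ (max C 0 * N ^ τ) * (max A 0 * ((1 / η + 1) * N ^ η)) :=
        mul_le_mul h2 hv1 hv0 (le_trans hdeg0 h2)
    _ = max C 0 * (max A 0 * (1 / η + 1)) * (N ^ τ * N ^ η) := by ring
    _ = max C 0 * (max A 0 * (1 / η + 1)) * N ^ σ := by rw [hexp]

/-! ## The relocation theorem: C⁺ ⟺ R modulo the two named facts -/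

/-- **C⁺ ⟹ R** — the line's composition (`SharpDegreeOfPolyDegree_of` of the skeleton
`Cruxes/SharpDegreeOfPolyDegree/Lines/Sketch.lean`) with its three open stubs as hypotheses: granted
`takahashi2001_thm_2_3` and `PastenShimura2024_minimalDegree_le_163_mul`, the residual stub C⁺
(under Poly, `ξ(E; N/q, q) ≤ C_ε N^{2+ε}` for semistable `E` in global minimal form and odd primes
`q ∣ N`) implies the crux `R = SharpDegreeOfPolyDegree` (`degreeBound_of_brandtXiBound` at
`θ = 2 + ε/2`, `η = ε/2`). [cite: Takahashi2001, Thm. 2.3] [cite: PastenShimura2024, §3 p. 13] -/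
theorem sharpDegreeOfPolyDegree_of_xiSharpUnderPoly (hT : takahashi2001_thm_2_3)
    (h163 : PastenShimura2024_minimalDegree_le_163_mul)
    (hC : (∃ κ C : ℝ, ∀ (W : WeierstrassCurve ℚ) [W.IsElliptic] [W.IsGloballyMinimal]
      [NeZero (W.conductorNorm ℤ)], W.IsSemistable ℤ →
        ∃ D : ModularParametrizationData W (W.conductorNorm ℤ),
          (D.modularDegree : ℝ) ≤ C * (W.conductorNorm ℤ : ℝ) ^ κ) →
      ∀ ε : ℝ, 0 < ε → ∃ C : ℝ, ∀ (W : WeierstrassCurve ℚ) [W.IsElliptic] [W.IsGloballyMinimal]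
        [NeZero (W.conductorNorm ℤ)], W.IsSemistable ℤ → ∀ q : ℕ, q.Prime → q ≠ 2 →
          q ∣ W.conductorNorm ℤ →
            (brandtXi (W.conductorNorm ℤ / q) q (fun n => W.LFunction n) : ℝ) ≤
              C * (W.conductorNorm ℤ : ℝ) ^ (2 + ε)) :
    SharpDegreeOfPolyDegree := by
  intro hPoly ε hε
  obtain ⟨C₁, hC₁⟩ := hC hPoly (ε / 2) (by positivity)
  exact degreeBound_of_brandtXiBound hT h163 hPoly hC₁ (η := ε / 2) (by positivity) (by ring)

/-- **The relocation theorem: C⁺ ⟺ R modulo the two named facts.** Granted `takahashi2001_thm_2_3`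
and `PastenShimura2024_minimalDegree_le_163_mul`, the residual stub C⁺ of the line `Sketch` is
EQUIVALENT to the crux `R = SharpDegreeOfPolyDegree` (`⟹`: the composition above; `⟸`: the landed
converse certificate `stub_xiSharpOfSharp`, Takahashi's identity read backwards).  The line
relocates `R` to the definite quaternion side exactly; it does not reduce its strength.
[cite: Takahashi2001, Thm. 2.3] [cite: MurtyCongruencePrimes1999, Thm. 1] -/
theorem xiSharpUnderPoly_iff_sharpDegreeOfPolyDegree (hT : takahashi2001_thm_2_3)
    (h163 : PastenShimura2024_minimalDegree_le_163_mul) :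
    ((∃ κ C : ℝ, ∀ (W : WeierstrassCurve ℚ) [W.IsElliptic] [W.IsGloballyMinimal]
      [NeZero (W.conductorNorm ℤ)], W.IsSemistable ℤ →
        ∃ D : ModularParametrizationData W (W.conductorNorm ℤ),
          (D.modularDegree : ℝ) ≤ C * (W.conductorNorm ℤ : ℝ) ^ κ) →
      ∀ ε : ℝ, 0 < ε → ∃ C : ℝ, ∀ (W : WeierstrassCurve ℚ) [W.IsElliptic] [W.IsGloballyMinimal]
        [NeZero (W.conductorNorm ℤ)], W.IsSemistable ℤ → ∀ q : ℕ, q.Prime → q ≠ 2 →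
          q ∣ W.conductorNorm ℤ →
            (brandtXi (W.conductorNorm ℤ / q) q (fun n => W.LFunction n) : ℝ) ≤
              C * (W.conductorNorm ℤ : ℝ) ^ (2 + ε)) ↔
    SharpDegreeOfPolyDegree :=
  ⟨sharpDegreeOfPolyDegree_of_xiSharpUnderPoly hT h163, stub_xiSharpOfSharp hT⟩

/-- **Registered stub `stub_xiSharpIffSharp` (the relocation theorem in arrow form):**
`takahashi2001_thm_2_3 → PastenShimura2024_minimalDegree_le_163_mul → (C⁺ ↔ R)`.
[cite: Takahashi2001, Thm. 2.3] [cite: PastenShimura2024, §3 p. 13] -/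
theorem stub_xiSharpIffSharp :
    takahashi2001_thm_2_3 → PastenShimura2024_minimalDegree_le_163_mul →
    (((∃ κ C : ℝ, ∀ (W : WeierstrassCurve ℚ) [W.IsElliptic] [W.IsGloballyMinimal]
      [NeZero (W.conductorNorm ℤ)], W.IsSemistable ℤ →
        ∃ D : ModularParametrizationData W (W.conductorNorm ℤ),
          (D.modularDegree : ℝ) ≤ C * (W.conductorNorm ℤ : ℝ) ^ κ) →
      ∀ ε : ℝ, 0 < ε → ∃ C : ℝ, ∀ (W : WeierstrassCurve ℚ) [W.IsElliptic] [W.IsGloballyMinimal]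
        [NeZero (W.conductorNorm ℤ)], W.IsSemistable ℤ → ∀ q : ℕ, q.Prime → q ≠ 2 →
          q ∣ W.conductorNorm ℤ →
            (brandtXi (W.conductorNorm ℤ / q) q (fun n => W.LFunction n) : ℝ) ≤
              C * (W.conductorNorm ℤ : ℝ) ^ (2 + ε)) ↔ SharpDegreeOfPolyDegree) :=
  fun hT h163 => xiSharpUnderPoly_iff_sharpDegreeOfPolyDegree hT h163

/-- **C⁺ ⟹ R with the `163`-fact phrased as the route item `MazurKenkuBound`** (stmt-ABC-15125; its
body is `PastenShimura2024_minimalDegree_le_163_mul` verbatim, so the two are definitionally equal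
and no rewriting is needed). [cite: PastenShimura2024, §3 p. 13] -/
theorem sharpDegreeOfPolyDegree_of_mazurKenkuBound_of_xiSharpUnderPoly (hT : takahashi2001_thm_2_3)
    (hMK : MazurKenkuBound)
    (hC : (∃ κ C : ℝ, ∀ (W : WeierstrassCurve ℚ) [W.IsElliptic] [W.IsGloballyMinimal]
      [NeZero (W.conductorNorm ℤ)], W.IsSemistable ℤ →
        ∃ D : ModularParametrizationData W (W.conductorNorm ℤ),
          (D.modularDegree : ℝ) ≤ C * (W.conductorNorm ℤ : ℝ) ^ κ) →
      ∀ ε : ℝ, 0 < ε → ∃ C : ℝ, ∀ (W : WeierstrassCurve ℚ) [W.IsElliptic] [W.IsGloballyMinimal]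
        [NeZero (W.conductorNorm ℤ)], W.IsSemistable ℤ → ∀ q : ℕ, q.Prime → q ≠ 2 →
          q ∣ W.conductorNorm ℤ →
            (brandtXi (W.conductorNorm ℤ / q) q (fun n => W.LFunction n) : ℝ) ≤
              C * (W.conductorNorm ℤ : ℝ) ^ (2 + ε)) :
    SharpDegreeOfPolyDegree :=
  sharpDegreeOfPolyDegree_of_xiSharpUnderPoly hT hMK hC

/-- **C⁺ ⟺ R modulo `takahashi2001_thm_2_3` and the route item `MazurKenkuBound`** (stmt-ABC-15125).
[cite: Takahashi2001, Thm. 2.3] -/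
theorem xiSharpUnderPoly_iff_sharpDegreeOfPolyDegree_of_mazurKenkuBound (hT : takahashi2001_thm_2_3)
    (hMK : MazurKenkuBound) :
    ((∃ κ C : ℝ, ∀ (W : WeierstrassCurve ℚ) [W.IsElliptic] [W.IsGloballyMinimal]
      [NeZero (W.conductorNorm ℤ)], W.IsSemistable ℤ →
        ∃ D : ModularParametrizationData W (W.conductorNorm ℤ),
          (D.modularDegree : ℝ) ≤ C * (W.conductorNorm ℤ : ℝ) ^ κ) →
      ∀ ε : ℝ, 0 < ε → ∃ C : ℝ, ∀ (W : WeierstrassCurve ℚ) [W.IsElliptic] [W.IsGloballyMinimal]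
        [NeZero (W.conductorNorm ℤ)], W.IsSemistable ℤ → ∀ q : ℕ, q.Prime → q ≠ 2 →
          q ∣ W.conductorNorm ℤ →
            (brandtXi (W.conductorNorm ℤ / q) q (fun n => W.LFunction n) : ℝ) ≤
              C * (W.conductorNorm ℤ : ℝ) ^ (2 + ε)) ↔
    SharpDegreeOfPolyDegree :=
  xiSharpUnderPoly_iff_sharpDegreeOfPolyDegree hT hMK

end Summit.ABC.ABC.Theorems.SharpDegreeOfPolyDegree

end
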